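import Summits.ResolutionOfSingularities.ResolutionOfSingularities.Theorems.PurelyInseparableDim4ChartAtlasSNCCriterion
import HarnessLib

/-!
# Purely inseparable four-folds `z^p + F(x₁, …, x₄)`: AFTER blowing up the boundary-at-infinity `Σ`, the strict transform of the
# escaping centre and the bad members separate — the second step of the repair candidate, chart level (cell `res-dim4-pi`, typ-2 g5)

[OURS · counted 0 · about OUR S3 (c) strategy; nothing about resolution of singularities] (D-0157 DOOR 2; DR-157-C; desk
WORD #131 (c)). Sequel of `…ChartAtlasSNCRepair` (Σ = V(z, x_T, x_j) IS snc with the bad pair). Blow up `𝔸⁵` (the chart-`x_l`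
model) along `Σ`, i.e. along `𝓘Λ_{Λ_Σ}`, `Λ_Σ = {z} ∪ T ∪ {j}` — ANY blowing up `π' : W' → 𝔸⁵` (`IsBlowup`) — and read its
`x_j`-chart (`AffineCoordBlowup.chartImm`). PROVED here (no `sorry`, no new axiom):

* `coordStrictTransformIdeal_IΛ_of_subset` (ring) — for `Λ' ⊆ Λ` and a chart variable `i₀ ∈ Λ ∖ Λ'`, the strict transform of
  `(xᵢ : i ∈ Λ')` is `(xᵢ : i ∈ Λ')` again; `comap_chartImm_strictTransformIdeal_idealSheafOf'` (any chart index of `Λ`);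
* **`comap_chartImm_strictTransformIdeal_𝓘Λ_of_subset`** — on the `x_j`-chart of `W'` the strict transform of the old centre
  `Zc = V(z, x_T)` reads `𝓘Λ_T` AGAIN; `comap_chartImm_strictTransformIdeal_𝓘Λ_eq_top_of_mem` — on every other chart `xᵢ`,
  `i ∈ Λ_T`, it is EMPTY; hence **`support_strictTransformIdeal_𝓘Λ_subset_opensRange`**: `V(St Zc) ⊆ W'[⊤, x_j]`;
* `strictTransformIdeal_specMap_subst_shear`, **`strictTransformIdeal_shear_comap_chartImm`** — the strict transform of the SHEARED
  bad member `(x_m + b x_j)·𝒪` (`m ∈ Λ_Σ`) reads `(x_m + b)·𝒪` on the `x_j`-chart: a translated coordinate hyperplane which, for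
  `b ≠ 0` and `m ∈ T`, MISSES `V(z, x_T)`; the other bad member `x_j·𝒪` has EMPTY strict transform there (tree
  `strictTransformIdeal_hyperplane_self_comap_chartImm`), and the new exceptional divisor reads `x_j·𝒪` (tree `comap_𝓘Λ_chartImm`).

READING: after the extra blow-up of `Σ` every boundary member through a point of `St(Zc)` reads, on the one chart carrying
`St(Zc)`, as a coordinate hyperplane with an index outside `T` or a member `xᵢ·𝒪`, `i ∈ T`, containing the centre — the
configuration of typ-2 g2's `hasSNCWith_translatedHyperplanes_𝓘Λ`; the bad pair no longer meets the centre. HONEST SCOPE: chart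
model; the global `HasSNCWith` after the repair also needs the members missing the centre to be snc among themselves away from it
(boundary snc, maintained by the blow-up sequence) — assembled by `…ChartAtlasGlue`, not here; planner's question whether the walk's
measure tolerates the extra blow-up. Resolution of singularities in dimension ≥ 4 / characteristic `p` is NOT proved anywhere in this
programme. bears_on: LADDER-RESOLUTION:D157-DOOR2 (res-dim4-pi). Supports stmt-ResolutionOfSingularities-16155 (helper, S3-N2 repair).
-/

-- every declaration of this summit lives under `Summit.ResolutionOfSingularities.ResolutionOfSingularities`
-- (summit = problem), which the duplicate-namespace linter flags; house convention (cf. the Target file).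
set_option linter.dupNamespace false

noncomputable section

open MvPolynomial Finset CategoryTheory AlgebraicGeometry Opposite TopologicalSpace
open AlgebraicGeometry.Scheme.IdealSheafData (ofIdealTop vanishingIdeal)

namespace Summit.ResolutionOfSingularities.ResolutionOfSingularities.Theorems.PIDim4

open Literature.AlgebraicGeometry.Resolution
open Literature.AlgebraicGeometry.Resolution.AffinePointBlowup (P A γ coord Wtop ξ)
open Literature.RingTheory.MvPolynomial (isPrime_span_X_image X_mem_span_X_image_iff)

namespace ChartDictionary

variable {K : Type} [Field K]

/-! ## §1 Ring level: the strict transform of a larger coordinate subspace through the centre -/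

/-- **`St(x_{Λ'}) = (x_{Λ'})` on the `x_{i₀}`-chart** for `Λ' ⊆ Λ` (the subspace `V(x_{Λ'})` CONTAINS the centre `V(x_Λ)`) and a
chart variable `i₀ ∈ Λ ∖ Λ'`. -/
theorem coordStrictTransformIdeal_IΛ_of_subset {Λ Λ' : Set (Fin (4 + 1))} (hsub : Λ' ⊆ Λ) {i₀ : Fin (4 + 1)}
    (hi₀' : i₀ ∉ Λ') :
    coordStrictTransformIdeal K Λ i₀ (AffineCoordBlowup.IΛ 4 K Λ') = AffineCoordBlowup.IΛ 4 K Λ' := by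
  classical
  have hprime : (AffineCoordBlowup.IΛ 4 K Λ').IsPrime := AffineCoordBlowup.isPrime_IΛ 4 K Λ'
  have hx : (X i₀ : A 4 K) ∉ AffineCoordBlowup.IΛ 4 K Λ' := fun h => hi₀' ((X_mem_span_X_image_iff (R := K)).mp h)
  have htot : (AffineCoordBlowup.IΛ 4 K Λ').map (coordBlowupSubst K Λ i₀ : A 4 K →+* A 4 K) ≤ AffineCoordBlowup.IΛ 4 K Λ' := by
    rw [AffineCoordBlowup.IΛ, Ideal.map_span, Ideal.span_le]
    rintro _ ⟨_, ⟨i, hi, rfl⟩, rfl⟩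
    have hii₀ : i ≠ i₀ := fun e => hi₀' (e ▸ hi)
    rw [SetLike.mem_coe, RingHom.coe_coe, coordBlowupSubst_X_of_mem_of_ne K Λ i₀ (hsub hi) hii₀]
    exact Ideal.mul_mem_left _ _ (Ideal.subset_span ⟨i, hi, rfl⟩)
  apply le_antisymm
  · rintro f ⟨N, hN⟩
    have h1 : X i₀ ^ N * f ∈ AffineCoordBlowup.IΛ 4 K Λ' := htot hN
    rcases hprime.mem_or_mem h1 with h2 | h2
    · exact absurd (hprime.mem_of_pow_mem N h2) hx
    · exact h2
  · rw [AffineCoordBlowup.IΛ, Ideal.span_le]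
    rintro _ ⟨i, hi, rfl⟩
    have hii₀ : i ≠ i₀ := fun e => hi₀' (e ▸ hi)
    refine mem_of_X_mul_mem K Λ i₀ ?_
    rw [← coordBlowupSubst_X_of_mem_of_ne K Λ i₀ (hsub hi) hii₀]
    exact coordBlowupSubst_mem K Λ i₀ (Ideal.subset_span ⟨i, hi, rfl⟩)

/-! ## §2 The strict transform of the old centre on the charts of `Bl_Σ` -/

section Chart

variable {Λ : Set (Fin (4 + 1))} {W : Scheme.{0}} {π : W ⟶ P 4 K}

/-- On ANY chart `xᵢ`, `i ∈ Λ`, of a blowing up of `𝔸⁵` along `V(x_Λ)`, the strict transform of `V(J)` reads `idealSheafOf (J^{st,i})`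
(B2's lemma for an arbitrary chart index). -/
theorem comap_chartImm_strictTransformIdeal_idealSheafOf' (hπ : IsBlowup π (AffineCoordBlowup.𝓘Λ 4 K Λ)) {i : Fin (4 + 1)}
    (hi : i ∈ Λ) (J : Ideal (A 4 K)) :
    (strictTransformIdeal π (AffineCoordBlowup.𝓘Λ 4 K Λ) (Hironaka2005.idealSheafOf J)).comap (AffineCoordBlowup.chartImm hπ hi) =
      Hironaka2005.idealSheafOf (coordStrictTransformIdeal K Λ i J) := by
  haveI : IsProper π := hπ.isProper
  haveI : IsLocallyNoetherian W := LocallyOfFiniteType.isLocallyNoetherian π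
  have hsq : AffineCoordBlowup.chartImm hπ hi ≫ π =
      Spec.map (CommRingCat.ofHom (coordBlowupSubst K Λ i : A 4 K →+* A 4 K)) ≫ 𝟙 (P 4 K) := by
    rw [Category.comp_id, AffineCoordBlowup.chartImm_comp hπ hi]
    rfl
  rw [comap_strictTransformIdeal_of_flat (t := 𝟙 (P 4 K)) hsq, Scheme.IdealSheafData.comap_id, Scheme.IdealSheafData.comap_id,
    Cruxes.EquisingularLiftNat.Sections.ND.𝓘Λ_eq_idealSheafOf,
    Cruxes.EquisingularLiftNat.Sections.ND.strictTransformIdeal_specMap_coordBlowupSubst K _ i hi]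

/-- **The strict transform of `V(x_{Λ'})` (`Λ' ⊆ Λ`) reads `𝓘Λ_{Λ'}` again on the chart `x_{i₀}`, `i₀ ∈ Λ ∖ Λ'`.** (For the repair:
`Λ = Λ_Σ = Λ_T ∪ {x_j}`, `Λ' = Λ_T`, `i₀ = x_j`: the old centre survives on the `x_j`-chart of `Bl_Σ`.) -/
theorem comap_chartImm_strictTransformIdeal_𝓘Λ_of_subset (hπ : IsBlowup π (AffineCoordBlowup.𝓘Λ 4 K Λ)) {Λ' : Set (Fin (4 + 1))}
    (hsub : Λ' ⊆ Λ) {i₀ : Fin (4 + 1)} (hi₀ : i₀ ∈ Λ) (hi₀' : i₀ ∉ Λ') :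
    (strictTransformIdeal π (AffineCoordBlowup.𝓘Λ 4 K Λ) (AffineCoordBlowup.𝓘Λ 4 K Λ')).comap (AffineCoordBlowup.chartImm hπ hi₀) =
      AffineCoordBlowup.𝓘Λ 4 K Λ' := by
  rw [Cruxes.EquisingularLiftNat.Sections.ND.𝓘Λ_eq_idealSheafOf 4 K Λ', comap_chartImm_strictTransformIdeal_idealSheafOf' hπ hi₀,
    coordStrictTransformIdeal_IΛ_of_subset hsub hi₀']

/-- **… and is EMPTY on the charts `xᵢ`, `i ∈ Λ'`** (the generator `xᵢ` becomes the exceptional unit). -/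
theorem comap_chartImm_strictTransformIdeal_𝓘Λ_eq_top_of_mem (hπ : IsBlowup π (AffineCoordBlowup.𝓘Λ 4 K Λ)) {Λ' : Set (Fin (4 + 1))}
    (hsub : Λ' ⊆ Λ) {i : Fin (4 + 1)} (hi' : i ∈ Λ') :
    (strictTransformIdeal π (AffineCoordBlowup.𝓘Λ 4 K Λ) (AffineCoordBlowup.𝓘Λ 4 K Λ')).comap (AffineCoordBlowup.chartImm hπ (hsub hi')) =
      ⊤ := by
  rw [Cruxes.EquisingularLiftNat.Sections.ND.𝓘Λ_eq_idealSheafOf 4 K Λ', comap_chartImm_strictTransformIdeal_idealSheafOf' hπ (hsub hi'),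
    coordStrictTransformIdeal_eq_top_of_X_mem K Λ i (Ideal.subset_span ⟨i, hi', rfl⟩ : (X i : A 4 K) ∈ AffineCoordBlowup.IΛ 4 K Λ'),
    Hironaka2005.idealSheafOf, Ideal.map_top]
  exact Scheme.IdealSheafData.ext_of_isAffine (by rw [ideal_ofIdealTop_top]; rfl)

/-- **`V(St V(x_{Λ'})) ⊆ W'[⊤, x_{i₀}]`** when `Λ = Λ' ∪ {i₀}`: the strict transform of the old centre lives entirely in ONE chart of
the blow-up of the larger coordinate subspace. -/
theorem support_strictTransformIdeal_𝓘Λ_subset_opensRange (hπ : IsBlowup π (AffineCoordBlowup.𝓘Λ 4 K Λ)) {Λ' : Set (Fin (4 + 1))}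
    (hsub : Λ' ⊆ Λ) {i₀ : Fin (4 + 1)} (hi₀ : i₀ ∈ Λ) (hΛ : Λ ⊆ insert i₀ Λ') :
    ((strictTransformIdeal π (AffineCoordBlowup.𝓘Λ 4 K Λ) (AffineCoordBlowup.𝓘Λ 4 K Λ')).support : Set W) ⊆
      (AffineCoordBlowup.chartImm hπ hi₀).opensRange := by
  intro w hw
  obtain ⟨⟨i, hi⟩, y, rfl⟩ := AffineCoordBlowup.exists_mem_opensRange_chartImm hπ w
  rcases (hΛ hi) with rfl | hi'
  · exact ⟨y, rfl⟩
  · -- on the chart `xᵢ`, `i ∈ Λ'`, the strict transform is empty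
    exfalso
    have h2 : y ∈ ((strictTransformIdeal π (AffineCoordBlowup.𝓘Λ 4 K Λ) (AffineCoordBlowup.𝓘Λ 4 K Λ')).comap
        (AffineCoordBlowup.chartImm hπ hi)).support := by
      rw [Scheme.IdealSheafData.support_comap]; exact hw
    rw [show AffineCoordBlowup.chartImm hπ hi = AffineCoordBlowup.chartImm hπ (hsub hi') from rfl,
      comap_chartImm_strictTransformIdeal_𝓘Λ_eq_top_of_mem hπ hsub hi', Scheme.IdealSheafData.support_top] at h2
    exact h2

end Chart

/-! ## §3 The sheared bad member after the blow-up of `Σ` -/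

section Shear

variable {S : Finset (Fin 4)} {j m : Fin 4} {W : Scheme.{0}} {π : W ⟶ P 4 K}

/-- Along `Spec ψ_j` (`j, m ∈ S`, `m ≠ j`): the strict transform of the sheared hyperplane `(x_m + b·x_j)·𝒪` is `(x_m + b)·𝒪`
(`ψ_j(x_m + b x_j) = x_j (x_m + b)` and `x_j ∤ x_m + b`). -/
theorem strictTransformIdeal_specMap_subst_shear (hj : j ∈ S) (hm : m ∈ S) (hmj : m ≠ j) (b : K) :
    strictTransformIdeal
        (Spec.map (CommRingCat.ofHom
          (coordBlowupSubst K (insert 0 (Fin.succ '' (S : Set (Fin 4)))) j.succ).toRingHom))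
        (AffineCoordBlowup.𝓘Λ 4 K (insert 0 (Fin.succ '' (S : Set (Fin 4)))))
        (ofIdealTop (Ideal.span {(γ 4 K).symm (X m.succ + C b * X j.succ)})) =
      ofIdealTop (Ideal.span {(γ 4 K).symm (X m.succ + C b)}) := by
  have hψ : coordBlowupSubst K (insert 0 (Fin.succ '' (S : Set (Fin 4)))) j.succ (X m.succ + C b * X j.succ) =
      X j.succ * (X m.succ + C b) := by
    rw [map_add, map_mul, coordBlowupSubst_C, coordBlowupSubst_X_self,
      coordBlowupSubst_X_of_mem_of_ne K _ j.succ (succ_mem_centreVars hm) (fun e => hmj (Fin.succ_inj.mp e))]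
    ring
  rw [strictTransformIdeal, comap_𝓘Λ_specMap_subst (succ_mem_centreVars hj), comap_ofIdealTop_span_γ_symm]
  change ⨆ k : ℕ, colon (ofIdealTop (Ideal.span {(γ 4 K).symm (coordBlowupSubst K _ j.succ (X m.succ + C b * X j.succ))}))
      (ofIdealTop (Ideal.span {coord 4 K j.succ}) ^ k) = _
  rw [hψ, map_mul, show (γ 4 K).symm (X j.succ) = coord 4 K j.succ from rfl,
    show coord 4 K j.succ * (γ 4 K).symm (X m.succ + C b) = coord 4 K j.succ ^ 1 * (γ 4 K).symm (X m.succ + C b) by rw [pow_one]]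
  simp_rw [← ofIdealTop_pow, colon_ofIdealTop]
  rw [← ofIdealTop_iSup, iSup_colon_span_pow_mul_eq (prime_coord j.succ) (not_coord_dvd_translate hmj b)]

/-- **THE SHEARED BAD MEMBER AFTER `Bl_Σ`: on the `x_j`-chart of ANY blowing up of `𝔸⁵` along `V(z, x_S)` (`j, m ∈ S`) the strict
transform of `(x_m + b·x_j)·𝒪` reads `(x_m + b)·𝒪`** — a translated coordinate hyperplane, which for `b ≠ 0` misses every
coordinate centre `V(z, x_T)` with `m ∈ T`. -/
theorem strictTransformIdeal_shear_comap_chartImm (hj : j ∈ S) (hm : m ∈ S) (hmj : m ≠ j) (b : K)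
    (hπ : IsBlowup π (AffineCoordBlowup.𝓘Λ 4 K (insert 0 (Fin.succ '' (S : Set (Fin 4)))))) :
    (strictTransformIdeal π (AffineCoordBlowup.𝓘Λ 4 K (insert 0 (Fin.succ '' (S : Set (Fin 4)))))
        (ofIdealTop (Ideal.span {(γ 4 K).symm (X m.succ + C b * X j.succ)}))).comap
        (AffineCoordBlowup.chartImm hπ (succ_mem_centreVars hj)) =
      ofIdealTop (Ideal.span {(γ 4 K).symm (X m.succ + C b)}) := by
  haveI : IsProper π := hπ.isProper
  haveI : IsLocallyNoetherian W := LocallyOfFiniteType.isLocallyNoetherian π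
  have hsq : AffineCoordBlowup.chartImm hπ (succ_mem_centreVars hj) ≫ π =
      Spec.map (CommRingCat.ofHom
        (coordBlowupSubst K (insert 0 (Fin.succ '' (S : Set (Fin 4)))) j.succ).toRingHom) ≫ 𝟙 (P 4 K) := by
    rw [Category.comp_id]
    exact AffineCoordBlowup.chartImm_comp hπ (succ_mem_centreVars hj)
  rw [comap_strictTransformIdeal_of_flat (t := 𝟙 (P 4 K)) hsq, Scheme.IdealSheafData.comap_id,
    Scheme.IdealSheafData.comap_id, strictTransformIdeal_specMap_subst_shear hj hm hmj b]

/-- The translated hyperplane `(x_m + b)·𝒪`, `b ≠ 0`, MISSES every coordinate centre `V(x_Λ)` with `x_m ∈ Λ`: their supports are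
disjoint. -/
theorem disjoint_support_translate_CΛ {Λ : Set (Fin (4 + 1))} (hm : m.succ ∈ Λ) {b : K} (hb : b ≠ 0) :
    Disjoint ((ofIdealTop (Ideal.span {(γ 4 K).symm (X m.succ + C b)})).support : Set (P 4 K))
      (AffineCoordBlowup.CΛ 4 K Λ : Set (P 4 K)) := by
  rw [Set.disjoint_left]
  intro y hy hyC
  rw [SetLike.mem_coe, ofIdealTop_span_γ_symm_eq_shf, Literature.AlgebraicGeometry.Hironaka2017.SpecOrders.mem_support_shf_iff,
    Ideal.span_singleton_le_iff_mem] at hy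
  have hXm : (X m.succ : A 4 K) ∈ y.asIdeal := (AffineCoordBlowup.mem_CΛ_iff' 4 K Λ y).mp hyC _ hm
  have hb' : (C b : A 4 K) ∈ y.asIdeal := by
    have h := y.asIdeal.sub_mem hy hXm
    rwa [add_sub_cancel_left] at h
  exact y.2.ne_top ((Ideal.eq_top_iff_one _).mpr (by
    have h := y.asIdeal.mul_mem_left (C b⁻¹) hb'
    rwa [← C_mul, inv_mul_cancel₀ hb, C_1] at h))

end Shear

end ChartDictionary

end Summit.ResolutionOfSingularities.ResolutionOfSingularities.Theorems.PIDim4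

end
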